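import Summits.ABC.IUTFork.Thm311RealInd1StripHullIdealsFloor
import Summits.ABC.IUTFork.Thm311RealInd1StripPacketHullWashout
import HarnessLib

/-!
# [IUTchIII] Thm 3.11 (i) (Ind1)+(Ind2) on a TENSOR PACKET of genuine completions: the packet FLOOR — modulo `JannsenWingbergMappingClass`, at
# tame factors of odd local degree `≥ 3`, the print-(Ind1) strip orbit span of a product of ideal-shaped factor regions has EXACTLY the
# `(R_I)^∼`-hull of Dupuy–Hilado's container span

PROOF-ONLY file (abc-iut cell, Cor. 3.12 sub-crew, seat abc-iut-c312-1 = holder of record of the typed [IUTchIII] Thm. 3.11, gen 15; row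
«R20 = C:PACKET-HULL-WASHOUT», file 3 — the conditional floor announced in `Thm311RealInd1StripPacketCeiling`).  TAKES NO SIDE on
[IUTchIII] Cor. 3.12.

* §1 (UNCONDITIONAL engine) **`tprod_mem_of_factor_closures`** — on `X = ⊗_{ℚ_p, i} K_{w_i}` let `N` be an additive subgroup containing the pure
  tensors `⊗_i x_i` of factor regions `M_i ⊆ K_{w_i}` and closed under SINGLE-FACTOR strip moves on pure tensors (`⊗ z ↦ ⊗ z[i₀ ↦ ψ z_{i₀}]`,
  `ψ ∈ Real.ind1StripOf w_{i₀} (galoisLog w_{i₀})` — print's (Ind1) strip part acting on one factor, the others fixed: a factorwise element as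
  in p516014's `hg`); then `N` contains EVERY pure tensor `⊗_i z_i` whose factors lie in the single-place two-step orbit spans
  `C_i = closure(M_i ∪ ψ(M_i) ∪ ψ'(ψ(M_i)))` (induction on the set of factors already moved; `⊗` is additive in each slot);
* §2 (mod `JannsenWingbergMappingClass`; every factor tame — `p > 2`, `e_i ≤ p − 2` — of ODD local degree `≥ 3`; factor regions the balls
  `c_i·𝔪_{w_i}^{n_i}`, `1 ≤ n_i ≤ e_i`, off the residue `n_i = e_i ∧ f_i = 1`) **`exists_tprod_mem_norm_eq_of_balls_of_jannsenWingbergMappingClass`**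
  — `N` contains a pure tensor `⊗_i y_i` with `‖y_i‖ = ‖c_i‖·p^{−1/e_i}` (the single-place floors `smul_inter_ker_subset_of_ball_of_…`, one per
  factor, fed to §1), whose component norms under any decomposition are the container's maximal radii; hence
  **`packetHull_eq_of_balls_of_jannsenWingbergMappingClass`**: if `N` lies inside the hull of the container span `(Π_i c_i)·log_p(R_I^×)` (the
  print orbit span does: print's factorwise group preserves it, p516014), then `packetHull(N) = packetHull((Π_i c_i)·log_p(R_I^×))` — print's
  (Ind1)⊔(Ind2) orbit span AS TYPED and Dupuy–Hilado's container orbit span have THE SAME `(R_I)^∼`-hull on such packets.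
READING (numbers about OUR typed objects): combined with the equality criterion of `Thm311RealInd1StripPacketCeiling` §3, at genuine packets all of
whose factors are tame of odd local degree `≥ 3` (and Θ-factor-regions off the one residue), reading (P)'s Θ-side computed over print's
(Ind1)⊔(Ind2) EQUALS the container's per-image number — modulo the Jannsen–Wingberg presentation with Kondo's mapping-class-group image; the
residues (degree 1 / even degree / wild / the `f = 1, n = e` bit) are those of the single-place files.  HONEST SCOPE: conditional on `hMC`;
OUR typing of print's (Ind1) (THE equivariant lift, THE logarithm; single-factor action as in p516014; F-B28-1 untouched); the Θ-region of
[IUTchIII] Cor. 3.12 is `ι(t)·(R_I)^∼ ⊇ ι(t)·R_I` — only its pure tensors of factor balls are used; nothing here computes a log-volume; no side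
taken on [IUTchIII] Cor. 3.12; NO abc claim. [claim: Mochizuki2012, status: disputed]; [cite: Mochizuki2012, IUTchIII Thm. 3.11 (i) p. 154; Rmk.
3.9.5 (i) p. 127; Cor. 3.12 Step (xi) p. 183; IUTchIV Prop. 1.4 (i) p. 13]; [cite: Kondo2025OuterAutMLF, §3 Thm 3.17, Rem 3.18];
[cite: DupuyHilado2025, §4.9, §4.12]. typed ≠ proved; a conditional theorem discharges nothing it binds.
-/

set_option autoImplicit false

noncomputable section

open Metric Set Bornology Function
open scoped Pointwise TensorProduct

namespace Summit.ABC.IUTFork.Thm311.Real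

open NumberField IsDedekindDomain Literature.NumberTheory.NumberFields Literature.IUT.LogVolume
open Literature.NumberTheory.GaloisRepresentations Literature.NumberTheory.GaloisRepresentations.Ultrametric
open Literature.AnabelianGeometry.AbsoluteAnabelian Literature.IUT.HodgeArakelov
open Literature.IUT.HodgeArakelov.AbsTopMonoids

variable {K : Type} [Field K] [NumberField K] (p : ℕ) [hp : Fact p.Prime]
variable {I : Type} [Fintype I] [DecidableEq I] (w : I → HeightOneSpectrum (𝓞 K)) (hw : ∀ i, ((p : ℕ) : 𝓞 K) ∈ (w i).asIdeal)

/-! ## §1 The engine: pure tensors of the single-place orbit spans lie in `N` -/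

/-- **Pure tensors of the single-place two-step orbit spans lie in `N` (UNCONDITIONAL).**  If `N ≤ X = ⊗_i K_{w_i}` contains the pure tensors of
the factor regions `M_i` and is closed under single-factor strip moves on pure tensors, then `⊗_i z_i ∈ N` whenever each `z_i` lies in the additive
span `C_i` of the two-step strip orbit of `M_i` (`M_i`, `ψ(M_i)`, `ψ'(ψ(M_i))`): induction on the factors already moved, using that `⊗` is
additive in each slot. [claim: Mochizuki2012, status: disputed] [cite: Mochizuki2012, IUTchIII Thm. 3.11 (i) p. 154] -/
theorem tprod_mem_of_factor_closures (M : ∀ i, Set ((w i).adicCompletion K))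
    (N : AddSubgroup (PacketAlgebra p (fun i => RescaledCompletion K p (w i) (hw i))))
    (hM : ∀ x : Π i, (w i).adicCompletion K, (∀ i, x i ∈ M i) →
      PiTensorProduct.tprod ℚ_[p] (fun i => RescaledCompletion.of K p (w i) (hw i) (x i)) ∈ N)
    (hN : ∀ (i₀ : I), ∀ ψ ∈ ind1StripOf (w i₀) (galoisLog (w i₀)), ∀ z : Π i, RescaledCompletion K p (w i) (hw i),
      PiTensorProduct.tprod ℚ_[p] z ∈ N →
        PiTensorProduct.tprod ℚ_[p] (update z i₀ (RescaledCompletion.of K p (w i₀) (hw i₀)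
          (ψ ((RescaledCompletion.of K p (w i₀) (hw i₀)).symm (z i₀))))) ∈ N)
    (z : Π i, RescaledCompletion K p (w i) (hw i))
    (hz : ∀ i, z i ∈ AddSubgroup.closure
      (RescaledCompletion.of K p (w i) (hw i) '' M i ∪
        ((⋃ ψ ∈ ind1StripOf (w i) (galoisLog (w i)), (fun x => RescaledCompletion.of K p (w i) (hw i) (ψ x)) '' M i) ∪
          ⋃ ψ ∈ ind1StripOf (w i) (galoisLog (w i)), ⋃ ψ' ∈ ind1StripOf (w i) (galoisLog (w i)),
            (fun x => RescaledCompletion.of K p (w i) (hw i) (ψ' (ψ x))) '' M i))) :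
    PiTensorProduct.tprod ℚ_[p] z ∈ N := by
  classical
  -- abbreviations
  set e := fun i => RescaledCompletion.of K p (w i) (hw i) with he_def
  let G : ∀ i, Set (RescaledCompletion K p (w i) (hw i)) := fun i =>
    e i '' M i ∪
      ((⋃ ψ ∈ ind1StripOf (w i) (galoisLog (w i)), (fun x => e i (ψ x)) '' M i) ∪
        ⋃ ψ ∈ ind1StripOf (w i) (galoisLog (w i)), ⋃ ψ' ∈ ind1StripOf (w i) (galoisLog (w i)), (fun x => e i (ψ' (ψ x))) '' M i)
  -- induction on the set `S` of slots carrying closure elements (the others carry `e(M)` elements)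
  suffices h : ∀ (S : Finset I) (z : Π i, RescaledCompletion K p (w i) (hw i)),
      (∀ i ∈ S, z i ∈ AddSubgroup.closure (G i)) → (∀ i ∉ S, z i ∈ e i '' M i) → PiTensorProduct.tprod ℚ_[p] z ∈ N from
    h Finset.univ z (fun i _ => hz i) (fun i hi => absurd (Finset.mem_univ i) hi)
  intro S
  induction S using Finset.induction_on with
  | empty =>
    intro z _ hzM
    choose x hxM hxz using fun i => hzM i (Finset.notMem_empty i)
    have : z = fun i => e i (x i) := funext fun i => (hxz i).symm
    rw [this]
    exact hM x hxM
  | insert a S haS ih =>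
    intro z hzC hzM
    -- the slot-`a` map `δ ↦ ⊗ z[a ↦ δ]` is additive; the set of `δ` landing in `N` is a subgroup `D`
    let φ : RescaledCompletion K p (w a) (hw a) →ₗ[ℚ_[p]] PacketAlgebra p (fun i => RescaledCompletion K p (w i) (hw i)) :=
      (PiTensorProduct.tprod ℚ_[p]).toLinearMap z a
    have hφ : ∀ δ, φ δ = PiTensorProduct.tprod ℚ_[p] (update z a δ) := fun δ => rfl
    let D : AddSubgroup (RescaledCompletion K p (w a) (hw a)) := N.comap φ.toAddMonoidHom
    -- every slot-`a` value from `e(M_a)` works, by the induction hypothesis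
    have hbase : ∀ x ∈ M a, PiTensorProduct.tprod ℚ_[p] (update z a (e a x)) ∈ N := by
      intro x hx
      refine ih (update z a (e a x)) (fun i hi => ?_) (fun i hi => ?_)
      · have hia : i ≠ a := fun h => haS (h ▸ hi)
        rw [update_of_ne hia]
        exact hzC i (Finset.mem_insert_of_mem hi)
      · by_cases hia : i = a
        · subst hia; rw [update_self]; exact ⟨x, hx, rfl⟩
        · rw [update_of_ne hia]
          exact hzM i (fun h => (Finset.mem_insert.mp h).elim hia hi)
    -- hence the generators of `C_a` lie in `D`
    have hgen : G a ⊆ (D : Set (RescaledCompletion K p (w a) (hw a))) := by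
      rintro δ (⟨x, hx, rfl⟩ | hδ | hδ)
      · change φ (e a x) ∈ N
        rw [hφ]; exact hbase x hx
      · simp only [Set.mem_iUnion, Set.mem_image] at hδ
        obtain ⟨ψ, hψ, x, hx, rfl⟩ := hδ
        change φ (e a (ψ x)) ∈ N
        rw [hφ]
        have h := hN a ψ hψ (update z a (e a x)) (hbase x hx)
        rwa [update_self, update_idem, show (e a).symm (e a x) = x from (e a).symm_apply_apply x] at h
      · simp only [Set.mem_iUnion, Set.mem_image] at hδ
        obtain ⟨ψ, hψ, ψ', hψ', x, hx, rfl⟩ := hδ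
        change φ (e a (ψ' (ψ x))) ∈ N
        rw [hφ]
        have h1 := hN a ψ hψ (update z a (e a x)) (hbase x hx)
        rw [update_self, update_idem, show (e a).symm (e a x) = x from (e a).symm_apply_apply x] at h1
        have h2 := hN a ψ' hψ' (update z a (e a (ψ x))) h1
        rwa [update_self, update_idem, show (e a).symm (e a (ψ x)) = ψ x from (e a).symm_apply_apply (ψ x)] at h2
    have hzaD : z a ∈ D := (AddSubgroup.closure_le D).mpr hgen (hzC a (Finset.mem_insert_self a S))
    have h : φ (z a) ∈ N := hzaD
    rwa [hφ, update_eq_self] at h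

/-! ## §2 The packet floor for products of ideal-shaped factor regions -/

/-- **A FULL-RADIUS PURE TENSOR IN THE PRINT-(Ind1) ORBIT SPAN (modulo `JannsenWingbergMappingClass`).**  On the genuine packet
`X = ⊗_{ℚ_p, i} K_{w_i}` with EVERY factor tame (`p > 2`, `e_i ≤ p − 2`) of ODD local degree `≥ 3`, let the factor regions be the balls
`{‖x‖ ≤ ‖c_i‖·p^{−n_i/e_i}}` (`c_i ≠ 0`, `1 ≤ n_i ≤ e_i`, NOT (`n_i = e_i ∧ f_i = 1`)).  Every additive subgroup `N ≤ X` containing their pure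
tensors and closed under single-factor strip moves on pure tensors contains a pure tensor `⊗_i y_i` with `‖y_i‖ = ‖c_i‖·p^{−1/e_i}` for all `i`
(the single-place floors p53xxxx `smul_inter_ker_subset_of_ball_of_jannsenWingbergMappingClass`, fed to §1). [claim: Mochizuki2012, status: disputed]
[cite: Mochizuki2012, IUTchIII Thm. 3.11 (i) p. 154] [cite: Kondo2025OuterAutMLF, §3 Thm 3.17, Rem 3.18] -/
theorem exists_tprod_mem_norm_eq_of_balls_of_jannsenWingbergMappingClass (hMC : JannsenWingbergMappingClass) (hp2 : 2 < p)
    (he : ∀ i, absRamificationIdx p (RescaledCompletion K p (w i) (hw i)) ≤ p - 2)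
    (h3 : ∀ i, 3 ≤ localDeg K (w i)) (hodd : ∀ i, Odd (localDeg K (w i)))
    (c : I → ℚ_[p]) (hc : ∀ i, c i ≠ 0) (n : I → ℕ) (hn1 : ∀ i, 1 ≤ n i)
    (hne : ∀ i, n i ≤ absRamificationIdx p (RescaledCompletion K p (w i) (hw i)))
    (hexc : ∀ i, ¬ (n i = absRamificationIdx p (RescaledCompletion K p (w i) (hw i)) ∧ (w i).asIdeal.inertiaDeg ℤ = 1))
    (N : AddSubgroup (PacketAlgebra p (fun i => RescaledCompletion K p (w i) (hw i))))
    (hM : ∀ x : Π i, (w i).adicCompletion K,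
      (∀ i, ‖RescaledCompletion.of K p (w i) (hw i) (x i)‖ ≤
        ‖c i‖ * (p : ℝ) ^ (-((n i : ℝ) / (absRamificationIdx p (RescaledCompletion K p (w i) (hw i)) : ℝ)))) →
      PiTensorProduct.tprod ℚ_[p] (fun i => RescaledCompletion.of K p (w i) (hw i) (x i)) ∈ N)
    (hN : ∀ (i₀ : I), ∀ ψ ∈ ind1StripOf (w i₀) (galoisLog (w i₀)), ∀ z : Π i, RescaledCompletion K p (w i) (hw i),
      PiTensorProduct.tprod ℚ_[p] z ∈ N →
        PiTensorProduct.tprod ℚ_[p] (update z i₀ (RescaledCompletion.of K p (w i₀) (hw i₀)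
          (ψ ((RescaledCompletion.of K p (w i₀) (hw i₀)).symm (z i₀))))) ∈ N) :
    ∃ y : Π i, RescaledCompletion K p (w i) (hw i),
      (∀ i, ‖y i‖ = ‖c i‖ * (p : ℝ) ^ (-(1 / (absRamificationIdx p (RescaledCompletion K p (w i) (hw i)) : ℝ)))) ∧
      PiTensorProduct.tprod ℚ_[p] y ∈ N := by
  classical
  -- per factor: the single-place floor applied to the two-step orbit span `C_i` of the ball
  let M : ∀ i, Set ((w i).adicCompletion K) := fun i =>
    {x | ‖RescaledCompletion.of K p (w i) (hw i) x‖ ≤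
      ‖c i‖ * (p : ℝ) ^ (-((n i : ℝ) / (absRamificationIdx p (RescaledCompletion K p (w i) (hw i)) : ℝ)))}
  let G : ∀ i, Set (RescaledCompletion K p (w i) (hw i)) := fun i =>
    RescaledCompletion.of K p (w i) (hw i) '' M i ∪
      ((⋃ ψ ∈ ind1StripOf (w i) (galoisLog (w i)), (fun x => RescaledCompletion.of K p (w i) (hw i) (ψ x)) '' M i) ∪
        ⋃ ψ ∈ ind1StripOf (w i) (galoisLog (w i)), ⋃ ψ' ∈ ind1StripOf (w i) (galoisLog (w i)),
          (fun x => RescaledCompletion.of K p (w i) (hw i) (ψ' (ψ x))) '' M i)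
  have hfac : ∀ i, ∃ y ∈ AddSubgroup.closure (G i),
      ‖y‖ = ‖c i‖ * (p : ℝ) ^ (-(1 / (absRamificationIdx p (RescaledCompletion K p (w i) (hw i)) : ℝ))) := by
    intro i
    obtain ⟨-, ⟨y, hy, hyn⟩, -⟩ := smul_inter_ker_subset_of_ball_of_jannsenWingbergMappingClass (w i) hMC p (hw i) hp2 (he i)
      (h3 i) (hodd i) (hc i) (hn1 i) (hne i) (hexc i) (AddSubgroup.closure (G i))
      (fun x hx => AddSubgroup.subset_closure (Or.inl ⟨x, hx, rfl⟩))
      (fun ψ hψ x hx => ⟨AddSubgroup.subset_closure (Or.inr (Or.inl (by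
          simp only [Set.mem_iUnion, Set.mem_image]; exact ⟨ψ, hψ, x, hx, rfl⟩))),
        fun ψ' hψ' => AddSubgroup.subset_closure (Or.inr (Or.inr (by
          simp only [Set.mem_iUnion, Set.mem_image]; exact ⟨ψ, hψ, ψ', hψ', x, hx, rfl⟩)))⟩)
    exact ⟨y, hy, hyn⟩
  choose y hyC hyn using hfac
  exact ⟨y, hyn, tprod_mem_of_factor_closures p w hw M N hM hN y hyC⟩

/-- **THE PACKET FLOOR = THE CONTAINER HULL (modulo `JannsenWingbergMappingClass`).**  Same setting (`I` nonempty).  If moreover `N` lies inside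
the `(R_I)^∼`-hull of the container span `(Π_i c_i)·log_p(R_I^×)` — as the print-(Ind1)⊔(Ind2) orbit span of the Θ-region does, print's
factorwise group preserving it (p516014) — then `packetHull(N) = packetHull((Π_i c_i)·log_p(R_I^×))`: the full-radius pure tensor of
`exists_tprod_mem_norm_eq_of_balls_…` realises the container's maximal radius in every component of any decomposition (here the chosen
`dEquiv`), so the two hulls have the same radii. [claim: Mochizuki2012, status: disputed] [cite: Mochizuki2012, IUTchIII Rmk. 3.9.5 (i) p. 127;
Cor. 3.12 Step (xi) p. 183; IUTchIV Prop. 1.4 (i) p. 13] [cite: DupuyHilado2025, §4.9, §4.12] -/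
theorem packetHull_eq_of_balls_of_jannsenWingbergMappingClass [Nonempty I] (hMC : JannsenWingbergMappingClass) (hp2 : 2 < p)
    (he : ∀ i, absRamificationIdx p (RescaledCompletion K p (w i) (hw i)) ≤ p - 2)
    (h3 : ∀ i, 3 ≤ localDeg K (w i)) (hodd : ∀ i, Odd (localDeg K (w i)))
    (c : I → ℚ_[p]) (hc : ∀ i, c i ≠ 0) (n : I → ℕ) (hn1 : ∀ i, 1 ≤ n i)
    (hne : ∀ i, n i ≤ absRamificationIdx p (RescaledCompletion K p (w i) (hw i)))
    (hexc : ∀ i, ¬ (n i = absRamificationIdx p (RescaledCompletion K p (w i) (hw i)) ∧ (w i).asIdeal.inertiaDeg ℤ = 1))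
    (N : AddSubgroup (PacketAlgebra p (fun i => RescaledCompletion K p (w i) (hw i))))
    (hM : ∀ x : Π i, (w i).adicCompletion K,
      (∀ i, ‖RescaledCompletion.of K p (w i) (hw i) (x i)‖ ≤
        ‖c i‖ * (p : ℝ) ^ (-((n i : ℝ) / (absRamificationIdx p (RescaledCompletion K p (w i) (hw i)) : ℝ)))) →
      PiTensorProduct.tprod ℚ_[p] (fun i => RescaledCompletion.of K p (w i) (hw i) (x i)) ∈ N)
    (hN : ∀ (i₀ : I), ∀ ψ ∈ ind1StripOf (w i₀) (galoisLog (w i₀)), ∀ z : Π i, RescaledCompletion K p (w i) (hw i),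
      PiTensorProduct.tprod ℚ_[p] z ∈ N →
        PiTensorProduct.tprod ℚ_[p] (update z i₀ (RescaledCompletion.of K p (w i₀) (hw i₀)
          (ψ ((RescaledCompletion.of K p (w i₀) (hw i₀)).symm (z i₀))))) ∈ N)
    (hNc : (N : Set (PacketAlgebra p (fun i => RescaledCompletion K p (w i) (hw i)))) ⊆
      packetHull p (fun i => RescaledCompletion K p (w i) (hw i))
        ((∏ i, c i) • (logPacket p (fun i => RescaledCompletion K p (w i) (hw i)) : Set _))) :
    packetHull p (fun i => RescaledCompletion K p (w i) (hw i)) (N : Set _) =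
      packetHull p (fun i => RescaledCompletion K p (w i) (hw i))
        ((∏ i, c i) • (logPacket p (fun i => RescaledCompletion K p (w i) (hw i)) : Set _)) := by
  classical
  obtain ⟨y, hyn, hyN⟩ := exists_tprod_mem_norm_eq_of_balls_of_jannsenWingbergMappingClass p w hw hMC hp2 he h3 hodd c hc n hn1
    hne hexc N hM hN
  set k := fun i => RescaledCompletion K p (w i) (hw i)
  set C : Set (PacketAlgebra p k) := (∏ i, c i) • (logPacket p k : Set (PacketAlgebra p k)) with hC
  set ψ := dEquiv p k
  -- co-radial maximal log-units in each factor (tame, degree ≥ 2)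
  have hd2 : ∀ i, 2 ≤ Module.finrank ℚ_[p] (k i) := fun i => by
    change 2 ≤ Module.finrank ℚ_[p] (RescaledCompletion K p (w i) (hw i))
    rw [finrank_rescaledCompletion_eq_localDeg]; exact (show 2 ≤ 3 by norm_num).trans (h3 i)
  have hmaxes : ∀ i, ∃ z ∈ logUnits (k i), ‖z‖ = (p : ℝ) ^ (-(1 / (absRamificationIdx p (k i) : ℝ))) ∧
      ∀ z' ∈ logUnits (k i), ‖z'‖ ≤ ‖z‖ := by
    intro i
    obtain ⟨z, hz, -, hzn, hzmax⟩ :=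
      TraceZeroCoradial.exists_mem_logUnits_trace_eq_zero_isMaxOn_of_tame p (k i) hp2 (he i) (hd2 i)
    exact ⟨z, hz, hzn, hzmax⟩
  choose zm hzm hzmn hzmax using hmaxes
  set R : ℝ := ‖∏ i, c i‖ * ∏ i, ‖zm i‖ with hR
  have hRy : ∀ j, ‖ψ (PiTensorProduct.tprod ℚ_[p] y) j‖ = R := by
    intro j
    have h := psi_purePacket_apply p k (DFac p k) ψ y j
    simp only [purePacket] at h
    rw [h, norm_prod, hR, norm_prod, ← Finset.prod_mul_distrib]
    refine Finset.prod_congr rfl fun i _ => ?_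
    rw [norm_factorEmb, hyn, hzmn]
  -- radii of the container and of `N`
  have hCle : ∀ x ∈ C, ∀ j, ‖ψ x j‖ ≤ R := fun x hx j =>
    PacketHull.norm_apply_le_of_mem_smul_logPacket p k (DFac p k) ψ zm hzmax (∏ i, c i) hx j
  have hR0 : 0 ≤ R := mul_nonneg (norm_nonneg _) (Finset.prod_nonneg fun i _ => norm_nonneg _)
  have hCbdd : IsBounded (ψ '' C) := by
    refine (isBounded_polydisc (DFac p k) (fun _ => R)).subset ?_
    rintro _ ⟨x, hx, rfl⟩
    exact (mem_polydisc (DFac p k)).mpr (hCle x hx)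
  have hradC : ∀ j, hullRadius (DFac p k) (ψ '' C) j ≤ R := fun j =>
    hullRadius_le_of_nonneg (DFac p k) hR0 (by rintro _ ⟨x, hx, rfl⟩; exact hCle x hx j)
  -- `ψ(N)` sits inside the hull polydisc of `ψ(C)`, hence is bounded with radii `≤` those of `ψ(C)`
  have hNsub : ψ '' (N : Set (PacketAlgebra p k)) ⊆ polydisc (DFac p k) (hullRadius (DFac p k) (ψ '' C)) := by
    rintro _ ⟨x, hx, rfl⟩
    have h := hNc hx
    rw [packetHull_eq_preimage_holomorphicHull p k (DFac p k) ψ hCbdd, Set.mem_preimage,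
      holomorphicHull_of_isBounded (DFac p k) hCbdd] at h
    exact h
  have hNbdd : IsBounded (ψ '' (N : Set (PacketAlgebra p k))) := (isBounded_polydisc (DFac p k) _).subset hNsub
  have hradN_le : ∀ j, hullRadius (DFac p k) (ψ '' (N : Set (PacketAlgebra p k))) j ≤ hullRadius (DFac p k) (ψ '' C) j := fun j =>
    hullRadius_le_of_subset_polydisc (DFac p k) (fun j => hullRadius_nonneg (DFac p k) _ j) hNsub j
  have hradN_ge : ∀ j, R ≤ hullRadius (DFac p k) (ψ '' (N : Set (PacketAlgebra p k))) j := by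
    intro j
    rw [← hRy j]
    exact norm_apply_le_hullRadius (DFac p k) hNbdd ⟨_, hyN, rfl⟩ j
  have hrad : ∀ j, hullRadius (DFac p k) (ψ '' (N : Set (PacketAlgebra p k))) j = hullRadius (DFac p k) (ψ '' C) j := fun j =>
    le_antisymm (hradN_le j) ((hradC j).trans (hradN_ge j))
  have hhull : holomorphicHull (DFac p k) (ψ '' (N : Set (PacketAlgebra p k))) = holomorphicHull (DFac p k) (ψ '' C) := by
    rw [holomorphicHull_of_isBounded (DFac p k) hNbdd, holomorphicHull_of_isBounded (DFac p k) hCbdd]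
    congr 1; funext j; exact hrad j
  rw [packetHull_eq_preimage_holomorphicHull p k (DFac p k) ψ hNbdd, packetHull_eq_preimage_holomorphicHull p k (DFac p k) ψ hCbdd, hhull]

end Summit.ABC.IUTFork.Thm311.Real

end
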